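import Summits.BirchSwinnertonDyer.BirchSwinnertonDyer.Theorems.GenusKolyvaginAtTwoPowDvdShaCardAtTwoRTGenusKernelHabitat
import Summits.BirchSwinnertonDyer.Rank1Residual.X11b.KolyvaginBottomPoint
import Literature.NumberTheory.EllipticCurves.QuadraticTwistRank
import Literature.NumberTheory.EllipticCurves.LeadingTermProofs
import Literature.NumberTheory.EllipticCurves.TwoAdicImageSurjectivityModTwoProofs
import Literature.NumberTheory.EllipticCurves.TwoTorsionOddDegreeBaseChangeProofs
import Literature.NumberTheory.EllipticCurves.MordellWeilTheoremProofs
import Literature.NumberTheory.EllipticCurves.BSDInvariantsProofs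
import Literature.NumberTheory.EllipticCurves.HeegnerPointsGaloisDescent
import Summits.BirchSwinnertonDyer.BirchSwinnertonDyer.Theorems.GenusKolyvaginAtTwoPowDvdShaCardAtTwoRTLadderFrameBookkeeping
import HarnessLib

/-!
# Route `GenusKolyvaginAtTwo`, LINE 18 (L_T `PowDvdShaCardAtTwoRT`, stmt-BirchSwinnertonDyer-23242), stub L
# `stub_twinShaLaddersAtTwo` — (R0): THE MEMBER OF THE ℚ-PAIR OF SIGN `w(E)` HAS RANK `0` AND ODD TORSION

Seat `bsd-line-gk2-p2` g18 (PROVER seat 2/3, cell `bsd-f1-sign2`), `--supports stmt-BirchSwinnertonDyer-23242` (helper; closes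
nothing). THEOREMS ONLY (no definition, no named fact, no `sorry`); BSD is not proved by any of this.

WHAT. The displayed hypothesis (R0) of the capstone `twinShaLadders_of_kolyvaginSuppliesAtTwo` — «`w(E) = 1 ∧ rank W(ℚ) = 0 ∧ #W(ℚ)_tors`
odd, or `w(E) = −1 ∧ rank Wd(ℚ) = 0 ∧ #Wd(ℚ)_tors` odd» — from `rank E(K) = 1` (Kolyvagin), a Heegner point `P ∈ E(K)` of infinite order
(`y_K`) and Gross's `τ P + w(E) P ∈ E(K)_tors` (Prop. 5.3 at conductor `1`, tree `X11b.isOfFinAddOrder_map_sub_neg_rootNumber_smul`):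
`rank W(ℚ) + rank W^{(d_K)}(ℚ) = 1` (`mordellWeilRank_add_eq_of_baseChange`), and the point `P − τP` (if `w = 1`) resp. `P + τP` (if
`w = −1`) is of infinite order and ANTI-fixed resp. FIXED, hence descends to `W^{(d_K)}(ℚ)` resp. `W(ℚ)` (Galois descent; the twist
isomorphism anti-commutes with `τ`, `map_twistPointEquiv_eq_neg`) — so the OTHER member has rank `0`. Odd torsion: `ρ̄_{E,2}` onto kills
rational `2`-torsion of `W` (Dokchitser–Dokchitser) and of every twist (same `2`-division polynomial count, `natCard_twoTorsion_quadraticTwist`).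

* `one_le_mordellWeilRank_of_forall_map_eq`, `one_le_mordellWeilRank_quadraticTwist_of_map_eq_neg` — positivity of the rank from a
  fixed / anti-fixed `K`-point of infinite order.
* `odd_torsionOrder_of_hasSurjectiveModNGaloisRep_two`, `odd_torsionOrder_quadraticTwist_of_hasSurjectiveModNGaloisRep_two`.
* **`rankZero_side_of_rootNumber`** — (R0) for `Wd = C • W^{(d_K)}` from `rank E(K) = 1`, a Heegner point of infinite order and `ρ̄_{E,2}` onto.

References: [GrossLMS1991] Thm. 1.3, §5 Prop. 5.3; [Darmon2004] Prop. 3.11, §3.9; [SilvermanAEC2009] Exercise 10.16, X.5 Cor. 5.4;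
[DokchitserDokchitserMathZ2012] Thm. (1).
-/

set_option autoImplicit false
-- the Theorems namespace of this sub repeats the summit name by design (D-0017 nested layout)
set_option linter.dupNamespace false

noncomputable section

open scoped Classical
-- every `DecidableEq ℚ` below must be the classical one used by the Literature lemmas on points (instance diamond on `E(ℚ)`)
attribute [local instance 10000] Classical.propDecidable

namespace Summit.BirchSwinnertonDyer.BirchSwinnertonDyer.Theorems.GenusExact.PlusDescent

open WeierstrassCurve NumberField Field Literature.NumberTheory.EllipticCurves
  Literature.NumberTheory.GaloisRepresentations

variable (K : Type) [Field K] [NumberField K]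

/-! ## §1 Positivity of the rank from a (anti-)fixed `K`-point of infinite order -/

/-- **A `Gal(K/ℚ)`-fixed point of infinite order in `X(K)` gives `rank X(ℚ) ≥ 1`** (Galois descent of the point, Mordell–Weil).
[cite: SilvermanAEC2009, VIII.§1, VIII.6] -/
theorem one_le_mordellWeilRank_of_forall_map_eq (X : WeierstrassCurve ℚ) [X.IsElliptic] [IsGalois ℚ K]
    {P : (X.baseChange K).toAffine.Point}
    (hfix : ∀ σ : K ≃ₐ[ℚ] K, WeierstrassCurve.Affine.Point.map (W' := X) (σ : K →ₐ[ℚ] K) P = P)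
    (hP : ¬ IsOfFinAddOrder P) : 1 ≤ X.mordellWeilRank := by
  obtain ⟨P₀, hP₀⟩ := exists_map_eq_of_forall_map_galois_eq X hfix
  have hP₀fin : ¬ IsOfFinAddOrder P₀ := fun h ↦ hP (by
    rw [← hP₀]
    exact (WeierstrassCurve.Affine.Point.map (W' := X) (algebraMap ℚ K).toRatAlgHom).isOfFinAddOrder h)
  have e : X.baseChange ℚ = X := by
    rw [WeierstrassCurve.baseChange, Algebra.algebraMap_self, WeierstrassCurve.map_id]
  haveI hell : (X.baseChange ℚ).IsElliptic := inferInstanceAs ((X.map (algebraMap ℚ ℚ)).IsElliptic)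
  have hfin : Module.Finite ℤ (X.baseChange ℚ).toAffine.Point := (X.baseChange ℚ).module_finite_point_holds
  have h : 1 ≤ (X.baseChange ℚ).mordellWeilRank :=
    one_le_mordellWeilRank_of_not_isOfFinAddOrder (X.baseChange ℚ) hfin hP₀fin
  have e' : (X.baseChange ℚ).mordellWeilRank = X.mordellWeilRank := by
    unfold WeierstrassCurve.mordellWeilRank
    rw [e]
  rwa [e'] at h

/-- **A `τ`-ANTI-fixed point of infinite order in `X(K)` gives `rank X^{(d)}(ℚ) ≥ 1`** for `K = ℚ(θ₀)`, `θ₀² = d`, `τθ₀ = −θ₀`,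
`Gal(K/ℚ) = {1, τ}`: through the twist isomorphism over `K` (anti-commuting with `τ`) the point becomes a FIXED point of `X^{(d)}(K)`.
[cite: SilvermanAEC2009, X.5 Cor. 5.4, Exercise 10.16] -/
theorem one_le_mordellWeilRank_quadraticTwist_of_map_eq_neg (X : WeierstrassCurve ℚ) [X.IsElliptic] [IsGalois ℚ K]
    {d : ℚ} (hd : d ≠ 0) {θ₀ : K} (hθ₀ : θ₀ ^ 2 = algebraMap ℚ K d) (τ : K ≃ₐ[ℚ] K) (hτθ : τ θ₀ = -θ₀)
    (hall : ∀ f : K ≃ₐ[ℚ] K, f = 1 ∨ f = τ)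
    {P : (X.baseChange K).toAffine.Point}
    (hanti : WeierstrassCurve.Affine.Point.map (W' := X) (τ : K →ₐ[ℚ] K) P = -P)
    (hP : ¬ IsOfFinAddOrder P) : 1 ≤ (X.quadraticTwist d).mordellWeilRank := by
  haveI := X.isElliptic_quadraticTwist hd
  set e := twistPointEquiv X (sqChange_spec X) hd hθ₀ with he
  set Q := e.symm P with hQ
  have heQ : e Q = P := by rw [hQ, AddEquiv.apply_symm_apply]
  -- `Q` is fixed by `τ`
  have hQτ : WeierstrassCurve.Affine.Point.map (W' := X.quadraticTwist d) (τ : K →ₐ[ℚ] K) Q = Q := by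
    apply e.injective
    have h := map_twistPointEquiv_eq_neg X K (sqChange_spec X) hd hθ₀ τ hτθ Q
    rw [heQ, hanti, neg_inj] at h
    rw [← h, heQ]
  have hQfix : ∀ σ : K ≃ₐ[ℚ] K, WeierstrassCurve.Affine.Point.map (W' := X.quadraticTwist d) (σ : K →ₐ[ℚ] K) Q = Q := by
    intro σ
    rcases hall σ with rfl | rfl
    · cases Q <;> rfl
    · exact hQτ
  have hQfin : ¬ IsOfFinAddOrder Q := fun h ↦ hP (by rw [← heQ]; exact e.toAddMonoidHom.isOfFinAddOrder h)
  exact one_le_mordellWeilRank_of_forall_map_eq K (X.quadraticTwist d) hQfix hQfin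

/-! ## §2 Odd torsion from `ρ̄_{E,2}` onto -/

/-- `ρ̄_{E,2}` onto ⟹ `#W(ℚ)_tors` odd. [cite: DokchitserDokchitserMathZ2012, Thm. (1)] [cite: SilvermanAEC2009, VIII.7] -/
theorem odd_torsionOrder_of_hasSurjectiveModNGaloisRep_two (W : WeierstrassCurve ℚ) [W.IsElliptic]
    (hs : W.HasSurjectiveModNGaloisRep 2) : Odd W.torsionOrder :=
  odd_torsionOrder_of_forall_two_nsmul W fun P hP ↦
    DokchitserDokchitser2012.forall_two_nsmul_of_hasSurjectiveModNGaloisRep_two W two_ne_zero hs P hP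

/-- `ρ̄_{E,2}` onto ⟹ `#W^{(d)}(ℚ)_tors` odd for every `d ≠ 0` (the twist has as many rational `2`-torsion points as `W`: none but `O`).
[cite: DokchitserDokchitserMathZ2012, Thm. (1)] [cite: SilvermanAEC2009, X.§5] -/
theorem odd_torsionOrder_quadraticTwist_of_hasSurjectiveModNGaloisRep_two (W : WeierstrassCurve ℚ) [W.IsElliptic]
    (hs : W.HasSurjectiveModNGaloisRep 2) {d : ℚ} (hd : d ≠ 0) :
    haveI := W.isElliptic_quadraticTwist hd
    Odd (W.quadraticTwist d).torsionOrder := by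
  haveI := W.isElliptic_quadraticTwist hd
  have hW := fun (P : W.toAffine.Point) hP ↦
    DokchitserDokchitser2012.forall_two_nsmul_of_hasSurjectiveModNGaloisRep_two W two_ne_zero hs P hP
  have hcard := natCard_twoTorsion_quadraticTwist W hd
  have h1 := hcard.trans (show _ = 1 by
    rw [Nat.card_eq_one_iff_unique]
    exact ⟨⟨fun a b ↦ Subtype.ext ((hW a.1 a.2).trans (hW b.1 b.2).symm)⟩, ⟨⟨0, nsmul_zero 2⟩⟩⟩)
  rw [Nat.card_eq_one_iff_unique] at h1
  refine odd_torsionOrder_of_forall_two_nsmul _ fun P hP ↦ ?_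
  have := h1.1.elim ⟨P, hP⟩ ⟨0, nsmul_zero 2⟩
  exact congrArg Subtype.val this

/-! ## §3 (R0) from Kolyvagin's `rank E(K) = 1` and Gross's sign of `y_K` -/

/-- **(R0): THE MEMBER OF SIGN `w(E)` HAS RANK `0` AND ODD TORSION.** `W/ℚ` globally minimal elliptic with `ρ̄_{E,2}` onto, `K` imaginary
quadratic and Heegner for `N_W` with `rank E(K) = 1` (Kolyvagin), `P ∈ E(K)` a Heegner point of infinite order (`y_K`), `Wd = C • W^{(d_K)}`:
if `w(E) = 1` then `rank W(ℚ) = 0` and `#W(ℚ)_tors` is odd; if `w(E) = −1` then `rank Wd(ℚ) = 0` and `#Wd(ℚ)_tors` is odd.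
[cite: GrossLMS1991, Thm. 1.3, §5 Prop. 5.3] [cite: Darmon2004, Prop. 3.11] [cite: SilvermanAEC2009, Exercise 10.16] -/
theorem rankZero_side_of_rootNumber (W : WeierstrassCurve ℚ) [W.IsElliptic] [W.IsGloballyMinimal] [NeZero (W.conductorNorm ℤ)]
    (hIQ : IsImaginaryQuadratic K) (hH : SatisfiesHeegnerHypothesis (W.conductorNorm ℤ) K)
    (hs : W.HasSurjectiveModNGaloisRep 2) (hrk : (W.baseChange K).mordellWeilRank = 1)
    {P : (W.baseChange K).toAffine.Point} (hP : IsHeegnerPoint (W.conductorNorm ℤ) W K P) (hnt : ¬ IsOfFinAddOrder P)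
    {Wd : WeierstrassCurve ℚ} [Wd.IsElliptic] (hWd : ∃ C : VariableChange ℚ, C • W.quadraticTwist (NumberField.discr K : ℚ) = Wd) :
    (W.rootNumber = 1 ∧ W.mordellWeilRank = 0 ∧ Odd W.torsionOrder) ∨
      (W.rootNumber = -1 ∧ Wd.mordellWeilRank = 0 ∧ Odd Wd.torsionOrder) := by
  have h2 : Module.finrank ℚ K = 2 := hIQ.1
  haveI : IsGalois ℚ K := isGalois_of_finrank_eq_two K h2
  obtain ⟨τ, θ₀, hτ, hθ₀, hsq, hτθ, hall⟩ := exists_gal_ne_one_sqrt_discr (K := K) h2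
  have hdK : (NumberField.discr K : ℚ) ≠ 0 := by exact_mod_cast NumberField.discr_ne_zero K
  obtain ⟨Cd, rfl⟩ := hWd
  haveI := W.isElliptic_quadraticTwist hdK
  -- `rank W + rank W^{(d_K)} = 1`
  have hsum := W.mordellWeilRank_add_eq_of_baseChange K h2 one_ne_zero hrk
  -- Gross: `τ P + w(E) P` is torsion
  have hgross := Summit.BirchSwinnertonDyer.Rank1Residual.X11b.KolyvaginBottom.isOfFinAddOrder_map_sub_neg_rootNumber_smul (W := W) hIQ hH hP τ hτ
  have hPτ2 : WeierstrassCurve.Affine.Point.map (W' := W) (τ : K →ₐ[ℚ] K)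
      (WeierstrassCurve.Affine.Point.map (W' := W) (τ : K →ₐ[ℚ] K) P) = P := by
    have hττ : τ * τ = 1 := by
      rcases hall (τ * τ) with h | h
      · exact h
      · exfalso; apply hτ
        have := congrArg (· * τ⁻¹) h
        simpa using this
    rw [WeierstrassCurve.Affine.Point.map_map]
    have : ((τ : K →ₐ[ℚ] K).comp (τ : K →ₐ[ℚ] K)) = AlgHom.id ℚ K := by
      ext x
      change τ (τ x) = x
      rw [← AlgEquiv.mul_apply, hττ, AlgEquiv.one_apply]
    rw [this]
    cases P <;> rfl
  rcases W.rootNumber_eq_one_or with hw | hw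
  · -- `w = 1`: `Q := P − τP` is anti-fixed of infinite order ⟹ `rank W^{(d)} ≥ 1` ⟹ `rank W = 0`
    left
    rw [hw] at hgross
    set τP := WeierstrassCurve.Affine.Point.map (W' := W) (τ : K →ₐ[ℚ] K) P with hτP
    have hQanti : WeierstrassCurve.Affine.Point.map (W' := W) (τ : K →ₐ[ℚ] K) (P - τP) = -(P - τP) := by
      rw [map_sub, hτP, hPτ2, neg_sub]
    have hQinf : ¬ IsOfFinAddOrder (P - τP) := by
      intro hfin
      -- `P − τP` torsion and `τP + P` torsion ⟹ `2P` torsion ⟹ `P` torsion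
      have h2P : IsOfFinAddOrder (P + P) := by
        have : P + P = (P - τP) + (τP - (-(1 : ℤ)) • P) := by rw [neg_one_zsmul, sub_neg_eq_add]; abel
        rw [this]
        exact hfin.add hgross
      rw [← two_nsmul] at h2P
      exact hnt (h2P.of_nsmul two_ne_zero)
    have h1 := one_le_mordellWeilRank_quadraticTwist_of_map_eq_neg K W hdK hsq τ hτθ hall hQanti hQinf
    have hW0 : W.mordellWeilRank = 0 := by
      have h' := Nat.add_le_add_left h1 W.mordellWeilRank
      rw [hsum] at h'
      exact Nat.lt_one_iff.mp h'
    exact ⟨hw, hW0, odd_torsionOrder_of_hasSurjectiveModNGaloisRep_two W hs⟩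
  · -- `w = −1`: `Q := P + τP` is fixed of infinite order ⟹ `rank W ≥ 1` ⟹ `rank W^{(d)} = 0 = rank Wd`
    right
    rw [hw, neg_neg] at hgross
    set τP := WeierstrassCurve.Affine.Point.map (W' := W) (τ : K →ₐ[ℚ] K) P with hτP
    have hQfix : ∀ σ : K ≃ₐ[ℚ] K, WeierstrassCurve.Affine.Point.map (W' := W) (σ : K →ₐ[ℚ] K) (P + τP) = P + τP := by
      intro σ
      rcases hall σ with rfl | rfl
      · cases (P + τP) <;> rfl
      · rw [map_add, hτP, hPτ2, add_comm]
    have hQinf : ¬ IsOfFinAddOrder (P + τP) := by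
      intro hfin
      have h2P : IsOfFinAddOrder (P + P) := by
        have : P + P = (P + τP) + -(τP - (1 : ℤ) • P) := by rw [one_zsmul]; abel
        rw [this]
        exact hfin.add hgross.neg
      rw [← two_nsmul] at h2P
      exact hnt (h2P.of_nsmul two_ne_zero)
    have h1 := one_le_mordellWeilRank_of_forall_map_eq K W hQfix hQinf
    have h0 : (W.quadraticTwist (NumberField.discr K : ℚ)).mordellWeilRank = 0 := by
      have h' := Nat.add_le_add_right h1 (W.quadraticTwist (NumberField.discr K : ℚ)).mordellWeilRank
      rw [hsum, add_comm] at h'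
      exact Nat.lt_one_iff.mp h'
    refine ⟨hw, ?_, ?_⟩
    · rw [W.quadraticTwist (NumberField.discr K : ℚ) |>.mordellWeilRank_variableChange_holds Cd, h0]
    · rw [(W.quadraticTwist (NumberField.discr K : ℚ)).torsionOrder_variableChange_holds Cd]
      exact odd_torsionOrder_quadraticTwist_of_hasSurjectiveModNGaloisRep_two W hs hdK

end Summit.BirchSwinnertonDyer.BirchSwinnertonDyer.Theorems.GenusExact.PlusDescent

end
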